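import Summits.ABC.IUTFork.Joshi.TensorPacketsJoshiCodomains
import Literature.Algebra.Homology.GroupCohomologyRestrictionCorestriction
import HarnessLib

/-!
# [J-III] Prop. 9.4.2.4 (4) SUPPLIED: `cores ∘ res = [L'_w : L_{mod,v}]` on genuine Galois cohomology
# (block E of the abc-iut cell, rung LADDER-ABC:A2.E; SUPPLIER DISCHARGE #2 of the batch-3 slot book, seat abc-iut-E-t48)

PROOF-ONLY companion of slot T-20's `Summits/ABC/IUTFork/Joshi/TensorPacketsJoshiCodomains.lean` (seat E-t20,
p429647): there, K. Joshi, *Construction of Arithmetic Teichmüller Spaces III*, arXiv:2401.13508v4 («Preliminary version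
for comments», unrefereed; bib `Joshi2024ATS3`), **Proposition 9.4.2.4 (2)–(4)** (render
`HOME/lit/renders/Joshi-arxiv-2401.13508/p0101.txt` l.51–73, proof p.102 l.1–2: «The proof is clear from the
constructions, the definitions of these objects and standard properties of Galois cohomology») is typed as the
HYPOTHESIS `TensorPacketDatum.CoresResDegree 𝕜 IQ MQ res cores deg y := ∀ w x, cores y w (res y w x) = deg w • x`
over ABSTRACT carriers `MQ y v` («`H¹_e(arith(L_mod)_y, ℚ_p(1))_v`»), `IQ y w` («`H¹_e(arith(L')_y, ℚ_p(1))_w`») and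
abstract `𝕜`-linear maps `res`, `cores` (parameters, never asserted).

THIS FILE supplies that hypothesis from the «standard property of Galois cohomology» it names, in the tree's
currency: for ANY family of local Galois groups `G_v` (`v ∈ V`), finite-index subgroups `G'_v ≤ G_v` (playing
`G_{L'_w} ≤ G_{L_{mod},v}`, index `[L'_w : L_{mod,v}]`) and `𝕜`-linear coefficient representations `A_{y,v}` of `G_v`
(one per arithmetic holomorphic structure `y`, e.g. `ℚ_p(1)` read in `y`), the carriers
`MQ y v := Hⁿ(G_v, A_{y,v})`, `IQ y v := Hⁿ(G'_v, Res A_{y,v})` (Mathlib `groupCohomology`), Mathlib's restriction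
`res := groupCohomology.map G'_v.subtype (𝟙 _) n` and the tree's corestriction (transfer)
`cores := Literature.Algebra.Homology.cores G'_v A_{y,v} n` (Brown, *Cohomology of Groups* III §9 (A)) satisfy
`CoresResDegree` with `deg v := [G_v : G'_v]` in EVERY degree `n` — by the tree's
`Literature.Algebra.Homology.cores_res_apply` (Brown III Prop. 9.5 (ii), `cor ∘ res = (G : H)`), nothing new asserted
(`coresResDegree_groupCohomology`). §2 carries the identity to any pair of `res`- and `cores`-stable `𝕜`-submodules
(the shape of Joshi's Bloch–Kato parts `H¹_e ⊂ H¹`; their stability under `res`/`cores` is an INPUT here, not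
asserted: `coresResDegree_restrict`), and §3 records that E-t20's conditional consequences (adelic form of (4),
Rmk. 9.4.6.9 «appearance of certain powers» on the packets) hold outright at this instantiation.

What this does NOT do: it does not identify Joshi's `H¹_e(arith(L')_y, ℚ_p(1))` with a specific Mathlib object (the
Bloch–Kato exponential / `H¹_e` is slot T-19's `BlochKatoDatum`, a signature), and it takes no side on [IUTchIII]
Cor. 3.12, on Joshi's claims, or on Mochizuki's report on them; typed ≠ proved ≠ endorsed; the cell locates /
conditionally verifies — NO abc claim. The supplied row bears on no test vs `S` (E-cx: Prop. 9.4.2.4 is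
dictionary/bookkeeping content, not an indeterminacy statement).
-/

noncomputable section

namespace Summit.ABC.IUTFork.Joshi

open Thm311 CategoryTheory

universe u

variable {T : ThetaIndex}

namespace TensorPacketDatum

variable (𝔇 : TensorPacketDatum T) (𝕜 : Type) [Field 𝕜]

/-! ## 1. The Galois-cohomology instantiation of `MQ`, `IQ`, `res`, `cores`, `deg` -/

section GroupCohomology

variable (Gal : T.V → Type) [∀ v, Group (Gal v)] (sub : ∀ v, Subgroup (Gal v)) [∀ v, (sub v).FiniteIndex]
variable (coeff : 𝔇.Arith → ∀ v : T.V, Rep 𝕜 (Gal v)) (n : ℕ)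

/-- `MQ y v := Hⁿ(G_{L_{mod},v}, A_{y,v})` — the `L_mod`-level local Galois cohomology carrier of [J-III]
Prop. 9.4.2.4 (p.101 l.51–57), instantiated at Mathlib's `groupCohomology` of the coefficient representation
`coeff y v` of the local group `Gal v`. [folklore] -/
abbrev HMod (y : 𝔇.Arith) (v : T.V) : Type := groupCohomology (coeff y v) n

/-- `IQ y w := Hⁿ(G_{L'_w}, Res A_{y,v})` — the `L'`-level carrier: cohomology of the finite-index subgroup
`sub v ≤ Gal v` (playing `G_{L'_w} ≤ G_{L_{mod},v}`) with the restricted coefficients. [folklore] -/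
abbrev HPrime (y : 𝔇.Arith) (v : T.V) : Type := groupCohomology (Rep.res (sub v).subtype (coeff y v)) n

/-- Prop. 9.4.2.4 (2) «the restriction homomorphism … which on each local factor is the restriction homomorphism
on Galois cohomology» — Mathlib's `res^{G_v}_{G'_v} = groupCohomology.map (sub v).subtype (𝟙 _) n`, as a
`𝕜`-linear map. [folklore] -/
def resMap (y : 𝔇.Arith) (v : T.V) : 𝔇.HMod 𝕜 Gal coeff n y v →ₗ[𝕜] 𝔇.HPrime 𝕜 Gal sub coeff n y v :=
  (groupCohomology.map (sub v).subtype (𝟙 (Rep.res (sub v).subtype (coeff y v))) n).hom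

/-- Prop. 9.4.2.4 (3) «the corestriction homomorphism … which on each local factor is the corestriction
homomorphism on Galois cohomology» — the tree's transfer `cor^{G_v}_{G'_v}` on Mathlib's carriers
(`Literature.Algebra.Homology.cores`, Brown III §9 (A)), as a `𝕜`-linear map.
[cite: Brown1982CohomologyGroups, III §9 (A) (p. 80)] -/
def coresMap (y : 𝔇.Arith) (v : T.V) : 𝔇.HPrime 𝕜 Gal sub coeff n y v →ₗ[𝕜] 𝔇.HMod 𝕜 Gal coeff n y v :=
  (Literature.Algebra.Homology.cores (sub v) (coeff y v) n).hom

/-- The local degree `[L'_w : L_{mod,v}] = [G_{L_{mod},v} : G_{L'_w}]`, i.e. the index of `sub v` in `Gal v`.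
[folklore] -/
def localDeg (v : T.V) : ℕ := (sub v).index

/-- **[J-III] Prop. 9.4.2.4 (4) SUPPLIED** (p.101 l.66–73 «The composite of restriction and corestriction is
multiplication by the local degree `[L'_w : L_{mod,v}]`»; proof p.102 l.1–2 «standard properties of Galois
cohomology»): at the Galois-cohomology instantiation (`HMod`, `HPrime`, `resMap`, `coresMap`, `localDeg`) E-t20's
hypothesis `CoresResDegree` HOLDS for every `y`, in every degree `n` — by Brown III Prop. 9.5 (ii)
`cor (res x) = (G : H) · x` (tree: `Literature.Algebra.Homology.cores_res_apply`).
[cite: Brown1982CohomologyGroups, III Prop. 9.5 (ii) (p. 82)] -/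
theorem coresResDegree_groupCohomology (y : 𝔇.Arith) :
    𝔇.CoresResDegree 𝕜 (𝔇.HPrime 𝕜 Gal sub coeff n) (𝔇.HMod 𝕜 Gal coeff n) (𝔇.resMap 𝕜 Gal sub coeff n)
      (𝔇.coresMap 𝕜 Gal sub coeff n) (localDeg Gal sub) y :=
  fun v x => Literature.Algebra.Homology.cores_res_apply (sub v) (coeff y v) n x

end GroupCohomology

/-! ## 2. The identity passes to `res`-stable and `cores`-stable sub-carriers (the shape of Joshi's `H¹_e ⊂ H¹`) -/

section Restrict

variable {𝕜}
variable {IQ : 𝔇.Arith → T.V → Type} [∀ y w, AddCommGroup (IQ y w)] [∀ y w, Module 𝕜 (IQ y w)]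
variable {MQ : 𝔇.Arith → T.V → Type} [∀ y v, AddCommGroup (MQ y v)] [∀ y v, Module 𝕜 (MQ y v)]
variable (res : ∀ (y : 𝔇.Arith) (w : T.V), MQ y w →ₗ[𝕜] IQ y w)
variable (cores : ∀ (y : 𝔇.Arith) (w : T.V), IQ y w →ₗ[𝕜] MQ y w) (deg : T.V → ℕ)
variable (N : ∀ (y : 𝔇.Arith) (w : T.V), Submodule 𝕜 (MQ y w)) (N' : ∀ (y : 𝔇.Arith) (w : T.V), Submodule 𝕜 (IQ y w))
variable (hres : ∀ y w, ∀ x ∈ N y w, res y w x ∈ N' y w) (hcores : ∀ y w, ∀ x ∈ N' y w, cores y w x ∈ N y w)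

/-- The restriction map carried to a pair of sub-carriers `N_{y,w} ⊆ MQ y w`, `N'_{y,w} ⊆ IQ y w` that it respects
(Joshi's `res : H¹_e(arith(L_mod)_y) → H¹_e(arith(L')_y)`, Prop. 9.4.2.4 (2), is the restriction of Galois
cohomology carried to the Bloch–Kato parts; that `res` preserves `H¹_e` is the INPUT `hres`, not asserted here).
[folklore] -/
def resRestrict (y : 𝔇.Arith) (w : T.V) : N y w →ₗ[𝕜] N' y w := (res y w).restrict (hres y w)

/-- The corestriction map carried to the sub-carriers (Prop. 9.4.2.4 (3); `cores` preserving `H¹_e` is the INPUT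
`hcores`). [folklore] -/
def coresRestrict (y : 𝔇.Arith) (w : T.V) : N' y w →ₗ[𝕜] N y w := (cores y w).restrict (hcores y w)

/-- **`CoresResDegree` is inherited by stable sub-carriers**: if `cores ∘ res = deg` on `MQ`, then the same holds
for the maps carried to any `res`- and `cores`-compatible pair of `𝕜`-submodules `N ⊆ MQ`, `N' ⊆ IQ` — so Prop.
9.4.2.4 (4) for the `H¹_e`-parts follows from (4) for full `H¹` plus the stability of `H¹_e`. [folklore] -/
theorem coresResDegree_restrict (h : ∀ y, 𝔇.CoresResDegree 𝕜 IQ MQ res cores deg y) (y : 𝔇.Arith) :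
    𝔇.CoresResDegree 𝕜 (fun y w => N' y w) (fun y w => N y w) (𝔇.resRestrict res N N' hres)
      (𝔇.coresRestrict cores N N' hcores) deg y := by
  intro w x
  apply Subtype.ext
  change cores y w (res y w (x : MQ y w)) = ((deg w • x : N y w) : MQ y w)
  rw [h y w, Submodule.coe_smul_of_tower]

end Restrict

/-! ## 3. E-t20's conditional consequences hold outright at the Galois-cohomology instantiation -/

section Consequences

variable (Gal : T.V → Type) [∀ v, Group (Gal v)] (sub : ∀ v, Subgroup (Gal v)) [∀ v, (sub v).FiniteIndex]
variable (coeff : 𝔇.Arith → ∀ v : T.V, Rep 𝕜 (Gal v)) (n : ℕ)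

/-- Prop. 9.4.2.4 (4), ADELIC form (p.101 l.66–73 «`(q_v) ↦ cores(res(q_v))` is the mapping
`(q_v) ↦ (q_v^{[L'_w : L_{mod,v}]})`», additively), UNCONDITIONAL at the Galois-cohomology instantiation:
E-t20's `adelicCores_adelicRes` with its hypothesis discharged by `coresResDegree_groupCohomology`.
[cite: Brown1982CohomologyGroups, III Prop. 9.5 (ii) (p. 82)] -/
theorem adelicCores_adelicRes_groupCohomology (y : 𝔇.Arith)
    (x : 𝔇.adelicH1eQ (𝔇.HMod 𝕜 Gal coeff n) y) :
    𝔇.adelicCores 𝕜 (𝔇.HPrime 𝕜 Gal sub coeff n) (𝔇.HMod 𝕜 Gal coeff n) (𝔇.coresMap 𝕜 Gal sub coeff n) y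
        (𝔇.adelicRes 𝕜 (𝔇.HPrime 𝕜 Gal sub coeff n) (𝔇.HMod 𝕜 Gal coeff n) (𝔇.resMap 𝕜 Gal sub coeff n) y x) =
      fun w => localDeg Gal sub w • x w :=
  𝔇.adelicCores_adelicRes 𝕜 _ _ _ _ _ y (𝔇.coresResDegree_groupCohomology 𝕜 Gal sub coeff n y) x

/-- [J-III] Rmk. 9.4.6.9 (p.104 l.65–70) «The composite, by Proposition 9.4.2.4, leads to the appearance of certain
powers in each factor», UNCONDITIONAL at the Galois-cohomology instantiation: on the pure tensors of the packet
`^{S_{j+1}}𝓘^{ℚ_p}_p` the composite `cores ∘ res` multiplies the `(a, w)`-component by the index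
`[G_v : G'_v] = [L'_w : L_{mod,v}]` (E-t20's `packetMap_cores_res_tprod`, hypothesis discharged).
[cite: Brown1982CohomologyGroups, III Prop. 9.5 (ii) (p. 82)] -/
theorem packetMap_cores_res_tprod_groupCohomology (z : T.Label → 𝔇.Arith) (j : T.Label) (p : T.VQ)
    (x : 𝔇.prodPacketQ (𝔇.HMod 𝕜 Gal coeff n) z j p) :
    𝔇.packetMap 𝕜 (𝔇.coresMap 𝕜 Gal sub coeff n) z j p
        (𝔇.packetMap 𝕜 (𝔇.resMap 𝕜 Gal sub coeff n) z j p (PiTensorProduct.tprod 𝕜 x)) =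
      PiTensorProduct.tprod 𝕜 fun a (w : T.Fibre p) => localDeg Gal sub w.1 • x a w :=
  𝔇.packetMap_cores_res_tprod 𝕜 _ _ _ _ _ (𝔇.coresResDegree_groupCohomology 𝕜 Gal sub coeff n) z j p x

/-- Rmk. 9.4.6.9, the powers made explicit, UNCONDITIONAL: if every `w ∈ V_p` has the same index `d` over
`L_{mod}` then `cores ∘ res` acts on the pure tensors of the `(j+1)`-fold packet as multiplication by `d^{j+1}`
(E-t20's `packetMap_cores_res_tprod_pow`, hypothesis discharged). [cite: Brown1982CohomologyGroups, III Prop. 9.5 (ii) (p. 82)] -/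
theorem packetMap_cores_res_tprod_pow_groupCohomology (z : T.Label → 𝔇.Arith) (j : T.Label) (p : T.VQ)
    (d : ℕ) (hd : ∀ w : T.Fibre p, localDeg Gal sub w.1 = d) (x : 𝔇.prodPacketQ (𝔇.HMod 𝕜 Gal coeff n) z j p) :
    𝔇.packetMap 𝕜 (𝔇.coresMap 𝕜 Gal sub coeff n) z j p
        (𝔇.packetMap 𝕜 (𝔇.resMap 𝕜 Gal sub coeff n) z j p (PiTensorProduct.tprod 𝕜 x)) =
      (d : 𝕜) ^ ((j : ℕ) + 1) • PiTensorProduct.tprod 𝕜 x :=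
  𝔇.packetMap_cores_res_tprod_pow 𝕜 _ _ _ _ _ (𝔇.coresResDegree_groupCohomology 𝕜 Gal sub coeff n) z j p d hd x

end Consequences

end TensorPacketDatum

end Summit.ABC.IUTFork.Joshi

end
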